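import Literature.AlgebraicGeometry.Shioda1982.ExceptionalQuadruplesComplete
import HarnessLib

/-!
# Shioda 1982 / Meyer–Neutsch 1981: no exceptional quadruple at the levels `174 ≤ N ≤ 175` absent from Tabelle 1 (kernel sweep)

Topic `Literature/AlgebraicGeometry/Shioda1982`; companion of `ExceptionalQuadruplesComplete.lean` (search `checkB`, soundness
`tabelleOneCompleteAt_of_chunks`, invariant form `exists_mem_reps_of_isExceptionalQuadruple`, statement `TabelleOneCompleteAt`; sources,
method and framing in its module docstring), of the sweeps `ExceptionalQuadruplesSweepSixty/…/Ninety.lean` (all `2 ≤ N ≤ 90`),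
`…SweepOneHundredTwelve.lean` (`N = 112`), `…SweepOneHundredThirtyTwo.lean` (`N = 132`) and of the other files of this series
(`ExceptionalQuadruplesSweep<lo>To<hi>.lean`, together: every level `91 ≤ N ≤ 179` that is not a row of Tabelle 1). THEOREMS only (no
definition, no named fact): the kernel search at each level `N` of this file's range that carries NO row of
[MeyerNeutsch1981Fermatquadrupel, Tabelle 1] (computer-generated there, "alle Fermatquadrupel für N ≤ 614 ermittelt", §2 p. 53; zeros of
[Shioda1982PicardFermat, table p. 727], whose non-zero entries `N ≤ 180` are exactly the 22 table levels): `completeAt_<N>` (every sorted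
pair-free primitive Hodge 4-multiset mod `N` is standard) and `not_isExceptionalQuadruple_<N>`. With the table levels
(`ExceptionalQuadruplesComplete*.lean`: the printed list is complete at each of its 22 levels `≤ 180`) the series makes Meyer–Neutsch's
classification of the exceptional surface classes kernel-certified at EVERY level `N ≤ 180`; above `180` there are none by Aoki's
Theorem C ([Aoki1983], computer-assisted for `181 ≤ m ≤ 672`, not a kernel statement). `decide +kernel` only (no `native_decide`),
chunked by first entries to bound the memory of a single kernel evaluation (≈ 0.9 ms of kernel time per candidate triple; this file
visits 302847 candidates).

HONEST FRAMING (cell `pub-hfermat`): explicit algebraic cycles for specific Hodge classes on Fermat/Delsarte varieties; residual open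
instances listed; no claim on general Hodge. These classes are algebraic (Lefschetz (1,1)); certified here is only the emptiness of the
exceptional list at these levels.

## References
* [MeyerNeutsch1981Fermatquadrupel] W. Meyer, W. Neutsch, *Fermatquadrupel*, Math. Ann. 256 (1981) 51–62, §2 p. 53, Tabelle 1 p. 54 (no rows 174, 175).
* [Shioda1982PicardFermat] T. Shioda, J. Fac. Sci. Univ. Tokyo IA 28 (1982) 725–734, table p. 727.
* [Aoki1983] N. Aoki, Math. Ann. 266 (1983) 23–54, Thm. C.
-/

namespace Literature.AlgebraicGeometry.Shioda1982

open Literature.AlgebraicGeometry.HodgeTheory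

set_option maxHeartbeats 0 in
/-- **Tabelle 1 is complete at `N = 174`, where it is empty**: every sorted Hodge 4-multiset mod `174` without a pair and with
`gcd = 1` is standard. Kernel exhaustion (`checkB`, 7 chunks of first entries, 150133 candidate triples).
[cite: MeyerNeutsch1981Fermatquadrupel, §2 p. 53 ("alle Fermatquadrupel für N ≤ 614 ermittelt") and Tabelle 1 p. 54 (no row 174)]
[cite: Shioda1982PicardFermat, table p. 727] -/
theorem completeAt_oneHundredSeventyFour : TabelleOneCompleteAt 174 :=
  tabelleOneCompleteAt_of_chunks 174 [(0, 9), (9, 9), (18, 9), (27, 9), (36, 11), (47, 19), (66, 108)] (by decide +kernel) (by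
    intro p hp
    simp only [List.mem_cons, List.not_mem_nil, or_false] at hp
    rcases hp with rfl | rfl | rfl | rfl | rfl | rfl | rfl <;> decide +kernel)

set_option maxHeartbeats 0 in
/-- **Tabelle 1 is complete at `N = 175`, where it is empty**: every sorted Hodge 4-multiset mod `175` without a pair and with
`gcd = 1` is standard. Kernel exhaustion (`checkB`, 7 chunks of first entries, 152714 candidate triples).
[cite: MeyerNeutsch1981Fermatquadrupel, §2 p. 53 ("alle Fermatquadrupel für N ≤ 614 ermittelt") and Tabelle 1 p. 54 (no row 175)]
[cite: Shioda1982PicardFermat, table p. 727] -/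
theorem completeAt_oneHundredSeventyFive : TabelleOneCompleteAt 175 :=
  tabelleOneCompleteAt_of_chunks 175 [(0, 9), (9, 8), (17, 9), (26, 9), (35, 10), (45, 15), (60, 115)] (by decide +kernel) (by
    intro p hp
    simp only [List.mem_cons, List.not_mem_nil, or_false] at hp
    rcases hp with rfl | rfl | rfl | rfl | rfl | rfl | rfl <;> decide +kernel)

/-- **No exceptional quadruple ("Ausnahmequadrupel") at the level `174`** (`tabelleOne 174 = []`).
[cite: MeyerNeutsch1981Fermatquadrupel, Tabelle 1 p. 54 (no row 174)] [cite: Shioda1982PicardFermat, table p. 727] -/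
theorem not_isExceptionalQuadruple_oneHundredSeventyFour (s : Multiset (ZMod 174)) : ¬ IsExceptionalQuadruple 174 s := by
  intro hs
  obtain ⟨r, hr, -⟩ := exists_mem_reps_of_isExceptionalQuadruple completeAt_oneHundredSeventyFour hs
  simp [reps, tabelleOne] at hr

/-- **No exceptional quadruple ("Ausnahmequadrupel") at the level `175`** (`tabelleOne 175 = []`).
[cite: MeyerNeutsch1981Fermatquadrupel, Tabelle 1 p. 54 (no row 175)] [cite: Shioda1982PicardFermat, table p. 727] -/
theorem not_isExceptionalQuadruple_oneHundredSeventyFive (s : Multiset (ZMod 175)) : ¬ IsExceptionalQuadruple 175 s := by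
  intro hs
  obtain ⟨r, hr, -⟩ := exists_mem_reps_of_isExceptionalQuadruple completeAt_oneHundredSeventyFive hs
  simp [reps, tabelleOne] at hr

end Literature.AlgebraicGeometry.Shioda1982
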